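import Summits.QuantumFields.GaugeBoot.LoopEquationInstances
import Summits.QuantumFields.GaugeBoot.WordLoop
import Summits.QuantumFields.GaugeBoot.Targets
import HarnessLib

/-!
# The `SU(2)` plaquette and spur-plaquette loop-equation rows in every dimension, in real loop variables

Cell `pub-gaugeboot` (HOME `run/shared/lean/pub/pub-gaugeboot/`), seat lean1 (binding layer), on top of lean2's L1
(`LoopEquationInstances.loopEquation_plaquette` / `loopEquation_spurPlaquette`, any `d`, `L ≥ 2`).
For `G = SU(2)` the plaquette terms are single-trace (`plaqTerm_su_two`) and `E[tr U_w] = 2·⟨W(w)⟩`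
(`integral_trace_su_two`), so the two rows of every rung-0 problem file of the cell read, in the cell's real loop
variables `⟨W(w)⟩ = wilsonExpectation (suRep 2) β (wordLoop (suRep 2) 0 w)` (tree coupling `β = β_std/2`):

* `su2_plaquetteRow`     : `3·⟨W(P)⟩ + β·Σ_{ν≠0} Σ_{ε} (⟨W(P·P̃_{ν,ε})⟩ − ⟨W(P·P̃_{ν,ε}⁻¹)⟩) = 0`, `P = +0 +1 −0 −1`;
* `su2_spurPlaquetteRow` : `β·Σ_{ν≠0} Σ_{ε} (⟨W(S·P̃_{ν,ε})⟩ − ⟨W(S·P̃_{ν,ε}⁻¹)⟩) = 0`, `S = +0 +0 +1 −0 −1 −0`,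

with `P̃_{ν,ε} = plaqWord 0 ν ε` the plaquettes through the marked edge `(0, e_0)`.  The identification of the raw
words with canonical loop classes (per dimension) is done in `Rung0D3LoopEqs` / `Rung0D4LoopEqs`.

HONEST FRAMING (page 1 of every file of this cell): exact identities between lattice expectations on finite tori at
stated coupling; NOT a mass gap, NOT a continuum limit, NOT a string tension, NOT large `N`; NOT
Yang–Mills-summit-bearing (`FixedCouplingUltralocality`, `PerturbativeInvisibility`).
-/

noncomputable section

open MeasureTheory Matrix
open Literature.MathematicalPhysics.QuantumFieldTheory
open Literature.MathematicalPhysics.QuantumLattice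

namespace Summit.QuantumFields.GaugeBoot

variable {d L : ℕ} [NeZero d] [NeZero L]

omit [NeZero d] in
/-- lean2's real expectation functional `E_w` is the cell's `⟨W(w)⟩ = wilsonExpectation (suRep 2) β (wordLoop (suRep 2) x w)`
(definitional). [folklore] -/
theorem wilsonExpectation_half_re_trace_eq (β : ℝ) (x : Site d L) (w : Word d) :
    wilsonExpectation (d := d) (L := L) (fundamentalRep (Fin 2)) β
        (fun U => ((2 : ℕ) : ℝ)⁻¹ * ((fundamentalRep (Fin 2) (wordHolonomy U x w)).trace).re) =
      wilsonExpectation (suRep 2) β (wordLoop (suRep 2) x w) := rfl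

/-- **The `SU(2)` plaquette row (1eq) in dimension `d`, real loop variables.**  For the plaquette `P = +0 +1 −0 −1`
based at `0`, the marked edge `(0, e_0)`, tree coupling `β` and every torus side `L ≥ 2`:
`3·⟨W(P)⟩ + β·Σ_{ν ≠ 0} Σ_ε (⟨W(P · plaqWord 0 ν ε)⟩ − ⟨W(P · (plaqWord 0 ν ε)⁻¹)⟩) = 0`. [folklore] -/
theorem su2_plaquetteRow (hL : (1 : ZMod L) ≠ 0) (h01 : (0 : Fin d) ≠ 1) (β : ℝ) :
    3 * wilsonExpectation (suRep 2) β (wordLoop (suRep 2) (0 : Site d L) (Word.plaquette 0 1)) +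
      β * ∑ ν ∈ Finset.univ.erase (0 : Fin d), ∑ ε : Bool,
        (wilsonExpectation (suRep 2) β (wordLoop (suRep 2) (0 : Site d L) (Word.plaquette 0 1 ++ plaqWord 0 ν ε)) -
          wilsonExpectation (suRep 2) β
            (wordLoop (suRep 2) (0 : Site d L) (Word.plaquette 0 1 ++ (plaqWord 0 ν ε).reverse))) = 0 := by
  have h := loopEquation_plaquette (L := L) (fundamentalLatticeRep 2) hL β (0 : Site d L) h01 1
    fun i j => sdPair_specialUnitaryGroup 2 β 0 0 0 _ _ (trace_unitDir_one i j)
  -- restate with the representation written out (definitional unfolding of `fundamentalLatticeRep 2`)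
  have h2 : ((2 : ℂ) - 1 / 2) * (∫ U, (fundamentalRep (Fin 2) (wordHolonomy U (0 : Site d L) (Word.plaquette 0 1))).trace
        ∂(wilsonMeasure (d := d) (L := L) (fundamentalRep (Fin 2)) β)) +
      (β / 2 : ℂ) * ∑ ν ∈ Finset.univ.erase (0 : Fin d), ∑ ε : Bool,
        ∫ U, plaqTerm (fundamentalRep (Fin 2)) 1 (0 : Site d L) 0 U (Word.plaquette 0 1) ν ε
          ∂(wilsonMeasure (d := d) (L := L) (fundamentalRep (Fin 2)) β) = 0 := h
  have hi : ∀ w : Word d, Integrable (fun U : GaugeConfig d L (Matrix.specialUnitaryGroup (Fin 2) ℂ) =>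
      (fundamentalRep (Fin 2) (wordHolonomy U (0 : Site d L) w)).trace)
        (wilsonMeasure (d := d) (L := L) (fundamentalRep (Fin 2)) β) :=
    fun w => integrable_of_continuous (fundamentalLatticeRep 2) β
      (continuous_trace_wordHolonomy (fundamentalLatticeRep 2) 0 w)
  simp_rw [plaqTerm_su_two, integral_sub (hi _) (hi _), integral_trace_su_two,
    wilsonExpectation_half_re_trace_eq] at h2
  have h3 : (((2 - 1 / 2) * (2 * wilsonExpectation (suRep 2) β (wordLoop (suRep 2) (0 : Site d L) (Word.plaquette 0 1))) +
      β / 2 * ∑ ν ∈ Finset.univ.erase (0 : Fin d), ∑ ε : Bool,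
        (2 * wilsonExpectation (suRep 2) β (wordLoop (suRep 2) (0 : Site d L) (Word.plaquette 0 1 ++ plaqWord 0 ν ε)) -
          2 * wilsonExpectation (suRep 2) β
            (wordLoop (suRep 2) (0 : Site d L) (Word.plaquette 0 1 ++ (plaqWord 0 ν ε).reverse))) : ℝ) : ℂ) = 0 := by
    push_cast at h2 ⊢
    exact h2
  have h4 := Complex.ofReal_eq_zero.1 h3
  simp only [← mul_sub, ← Finset.mul_sum] at h4
  linear_combination h4

/-- **The `SU(2)` spur-plaquette row (2eq) in dimension `d`, real loop variables.**  For the spur-plaquette word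
`S = +0 +0 +1 −0 −1 −0` based at `0`, the marked edge `(0, e_0)`, tree coupling `β` and every torus side `L ≥ 2`:
`β·Σ_{ν ≠ 0} Σ_ε (⟨W(S · plaqWord 0 ν ε)⟩ − ⟨W(S · (plaqWord 0 ν ε)⁻¹)⟩) = 0` (the split terms cancel). [folklore] -/
theorem su2_spurPlaquetteRow (hL : (1 : ZMod L) ≠ 0) (h01 : (0 : Fin d) ≠ 1) (β : ℝ) :
    β * ∑ ν ∈ Finset.univ.erase (0 : Fin d), ∑ ε : Bool,
        (wilsonExpectation (suRep 2) β (wordLoop (suRep 2) (0 : Site d L) (Word.spurPlaquette 0 1 ++ plaqWord 0 ν ε)) -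
          wilsonExpectation (suRep 2) β
            (wordLoop (suRep 2) (0 : Site d L) (Word.spurPlaquette 0 1 ++ (plaqWord 0 ν ε).reverse))) = 0 := by
  have h := loopEquation_spurPlaquette (L := L) (fundamentalLatticeRep 2) hL β (0 : Site d L) h01 1
    fun i j => sdPair_specialUnitaryGroup 2 β 0 0 0 _ _ (trace_unitDir_one i j)
  have h2 : (β / 2 : ℂ) * ∑ ν ∈ Finset.univ.erase (0 : Fin d), ∑ ε : Bool,
        ∫ U, plaqTerm (fundamentalRep (Fin 2)) 1 (0 : Site d L) 0 U (Word.spurPlaquette 0 1) ν ε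
          ∂(wilsonMeasure (d := d) (L := L) (fundamentalRep (Fin 2)) β) = 0 := h
  have hi : ∀ w : Word d, Integrable (fun U : GaugeConfig d L (Matrix.specialUnitaryGroup (Fin 2) ℂ) =>
      (fundamentalRep (Fin 2) (wordHolonomy U (0 : Site d L) w)).trace)
        (wilsonMeasure (d := d) (L := L) (fundamentalRep (Fin 2)) β) :=
    fun w => integrable_of_continuous (fundamentalLatticeRep 2) β
      (continuous_trace_wordHolonomy (fundamentalLatticeRep 2) 0 w)
  simp_rw [plaqTerm_su_two, integral_sub (hi _) (hi _), integral_trace_su_two,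
    wilsonExpectation_half_re_trace_eq] at h2
  have h3 : ((β / 2 * ∑ ν ∈ Finset.univ.erase (0 : Fin d), ∑ ε : Bool,
        (2 * wilsonExpectation (suRep 2) β (wordLoop (suRep 2) (0 : Site d L) (Word.spurPlaquette 0 1 ++ plaqWord 0 ν ε)) -
          2 * wilsonExpectation (suRep 2) β
            (wordLoop (suRep 2) (0 : Site d L) (Word.spurPlaquette 0 1 ++ (plaqWord 0 ν ε).reverse))) : ℝ) : ℂ) = 0 := by
    push_cast at h2 ⊢
    exact h2
  have h4 := Complex.ofReal_eq_zero.1 h3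
  simp only [← mul_sub, ← Finset.mul_sum] at h4
  linear_combination h4

end Summit.QuantumFields.GaugeBoot

end
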